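import Literature.AlgebraicGeometry.Morphisms.FormalFunctionsGradedCechProofs
import Literature.AlgebraicGeometry.Morphisms.CechH1Pullback
import Mathlib.AlgebraicGeometry.IdealSheaf.Subscheme
import Mathlib.AlgebraicGeometry.Morphisms.ClosedImmersion
import Mathlib.AlgebraicGeometry.Noetherian
import HarnessLib

/-!
# Torsion data for the graded Čech cohomology of a principal ideal `I = (a)`

Sibling proofs file of `Literature/AlgebraicGeometry/Morphisms/FormalFunctionsGradedCechProofs.lean`
(graded Čech cohomology `Ȟ¹(𝒰, 𝓘^{n+1})` of the powers of `𝓘 = I 𝒪_X`, `H1`, `ρ`, `Z1`, `B1`, `C0`,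
`C1`) and `Literature/AlgebraicGeometry/Morphisms/CechH1Pullback.lean` (pull-back of Čech cochains
along a morphism of `A`-schemes). For a PRINCIPAL ideal `I = (a)` of `A`, an `A`-scheme
`f : X → Spec A` with `X` locally Noetherian, and a finite family of opens `𝒰` with affine members,
pairwise and triple intersections, we construct the **torsion data** consumed by
`InfinitesimalCech.exists_restrict_eq_of_torsionData`
(`Literature/AlgebraicGeometry/Morphisms/FormalFunctionsTorsionML.lean`):

* `TorsionCech.imageι_app_eq_zero_iff`, `imageι_app_surjective` — for the scheme-theoretic closure
  `X̄ ⊆ X` of the open `X_a = D(a)` (Mathlib `Scheme.Hom.image` of the quasi-compact open immersion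
  `X_a → X`) and an affine open `W`, the restriction `Γ(X, W) → Γ(X̄, X̄ ∩ W)` is onto and its kernel
  is the `a`-power torsion of `Γ(X, W)` (`= ker (Γ(W) → Γ(W ∩ D(a)) = Γ(W)[1/a])`, Mathlib
  `Scheme.Hom.ker_apply`, `IdealSheafData.ker_subschemeι_app`, `IsAffineOpen.isLocalization_basicOpen`);
* `TorsionCech.exists_uniform_pow_smul_eq_zero` — one power `a^N` kills the `a`-power torsion of
  finitely many Noetherian rings `Γ(X, W_p)`;
* `TorsionCech.exists_torsionData_of`, `exists_torsionData` — for any `g : Y → X` with these two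
  properties on affine opens (in particular `X̄ → X`) there are `n₀` and `A`-linear maps
  `Ψ_r : Ȟ¹(𝒰, 𝓘^{n₀+r+1}) → Ȟ¹(g⁻¹𝒰, 𝒪_Y)`, `[a^{n₀+r+1} d] ↦ [d|_Y]` (well defined: a cochain of
  `𝓘^{n+1}` on affine opens is `a^{n+1} d`, `exists_eq_pow_smul_of_app_ι_eq_zero`, and two choices
  of `d` differ by torsion, which dies on `Y`), with `Ψ_r ∘ ρ = a • Ψ_{r+1}` and `Ψ_0` injective
  (`n₀ = N`: if `d|_Y = d⁰ ē`, lift `ē` to `e` on the affine `U_i`; then `d - d⁰ e` is torsion, so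
  `a^{n+1} d = d⁰ (a^{n+1} e)` is a coboundary of `𝓘^{n+1}`).

With the finiteness of `Ȟ¹(𝒰 ∩ X̄, 𝒪_X̄)` for projective `X` (the tree's
`moduleFinite_cechH1_of_isClosedImmersion`) this yields the Mittag-Leffler property of
`(Γ(X_n, 𝒪))_n`, `X_n = X ×_A A/(a^{n+1})`, without the graded finiteness theorem over the Rees
algebra — the classical treatment of formal functions along a principal ideal through the
stabilisation of `a`-power torsion (cf. The Stacks Project, Tag 02OB, Cohomology of Schemes,
Lemma 30.20.1). Everything is proved; the file declares theorems only; no named facts are introduced.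

## References

* The Stacks Project, Tag 02OB (Cohomology of Schemes, Lemma 30.20.1), Tag 02OC (Theorem 30.20.5),
  Tag 01R8 (Morphisms, Section 29.6: scheme theoretic image).
* U. Görtz, T. Wedhorn, *Algebraic Geometry II*, Springer Spektrum (2023), Lemma 24.40.
-/

noncomputable section

open CategoryTheory AlgebraicGeometry Limits TopologicalSpace Opposite

universe u v

namespace Literature.AlgebraicGeometry.Morphisms

namespace TorsionCech

open infinitesimalNeighbourhood InfinitesimalCech

variable {A : Type u} [CommRing A] {X : Scheme.{u}} (f : X ⟶ Spec (.of A)) (a : A)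

/-! ### Restriction to equal opens -/

/-- Restrictions of a section to two equal opens vanish simultaneously. [folklore] -/
theorem map_eq_zero_iff_of_eq {W V₁ V₂ : X.Opens} (e : V₁ = V₂) (h₁ : V₁ ≤ W) (h₂ : V₂ ≤ W)
    (x : Γ(X, W)) :
    X.presheaf.map (homOfLE h₁).op x = 0 ↔ X.presheaf.map (homOfLE h₂).op x = 0 := by
  subst e
  rfl

/-! ### The open `X_a` where `a` is invertible and the closed subscheme `X̄ = closure of X_a` -/

/-- Sections of `W` restricting to zero on `W ∩ X_a` (`X_a = D(a)`, `W` affine) are exactly the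
`a`-power torsion sections: `Γ(W ∩ D(a)) = Γ(W)[1/a]` (Mathlib `IsAffineOpen.isLocalization_basicOpen`).
[folklore] -/
theorem app_basicOpen_ι_eq_zero_iff {W : X.Opens} (hW : IsAffineOpen W) (x : Sections f W) :
    ((X.basicOpen (algebraMapΓ f a)).ι.app W).hom x = 0 ↔ ∃ n : ℕ, a ^ n • x = 0 := by
  set s : Γ(X, ⊤) := algebraMapΓ f a with hs
  set sW : Γ(X, W) := X.presheaf.map (homOfLE (le_top : W ≤ ⊤)).op s with hsW
  -- the target open of `ι.app W` is `W ∩ D(a) = D(a|_W)`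
  have e1 : (X.basicOpen s).ι ''ᵁ (X.basicOpen s).ι ⁻¹ᵁ W = X.basicOpen s ⊓ W := by
    rw [Scheme.Hom.image_preimage_eq_opensRange_inf, Scheme.Opens.opensRange_ι]
  have e2 : X.basicOpen sW = W ⊓ X.basicOpen s := by
    rw [hsW]; exact X.basicOpen_res s (homOfLE (le_top : W ≤ ⊤)).op
  have e3 : (X.basicOpen s).ι ''ᵁ (X.basicOpen s).ι ⁻¹ᵁ W = X.basicOpen sW := by
    rw [e1, e2, inf_comm]
  rw [Scheme.Opens.ι_app]
  change X.presheaf.map (homOfLE _).op x = 0 ↔ _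
  rw [map_eq_zero_iff_of_eq e3 _ (X.basicOpen_le sW) x]
  -- `Γ(X, D(a|_W))` is the localisation of `Γ(X, W)` at `a|_W`
  letI := (X.presheaf.map (homOfLE (X.basicOpen_le sW)).op).hom.toAlgebra
  haveI : IsLocalization.Away sW Γ(X, X.basicOpen sW) := hW.isLocalization_basicOpen sW
  change algebraMap Γ(X, W) Γ(X, X.basicOpen sW) x = 0 ↔ _
  rw [IsLocalization.map_eq_zero_iff (Submonoid.powers sW)]
  constructor
  · rintro ⟨⟨_, n, rfl⟩, hn⟩
    exact ⟨n, by rw [Algebra.smul_def, map_pow]; exact hn⟩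
  · rintro ⟨n, hn⟩
    exact ⟨⟨sW ^ n, n, rfl⟩, by rw [Algebra.smul_def, map_pow] at hn; exact hn⟩

/-- The kernel of `Γ(W) → Γ(X̄ ∩ W)` (`W` affine, `X̄` the scheme-theoretic closure of
`X_a = D(a)` in `X`) is the `a`-power torsion: the ideal of the scheme-theoretic image of the
quasi-compact open immersion `X_a → X` is the kernel of restriction to `X_a` (Mathlib
`Scheme.Hom.ker_apply`, `IdealSheafData.ker_subschemeι_app`). [folklore] -/
theorem imageι_app_eq_zero_iff {W : X.Opens} (hW : IsAffineOpen W) (x : Sections f W) :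
    ((X.basicOpen (algebraMapΓ f a)).ι.imageι.app W).hom x = 0 ↔ ∃ n : ℕ, a ^ n • x = 0 := by
  rw [← app_basicOpen_ι_eq_zero_iff f a hW x, ← RingHom.mem_ker, ← RingHom.mem_ker,
    Scheme.Hom.imageι, Scheme.IdealSheafData.ker_subschemeι_app _ ⟨W, hW⟩,
    Scheme.Hom.ker_apply _ ⟨W, hW⟩]

/-- `Γ(W) → Γ(X̄ ∩ W)` is onto for `W` affine (`X̄ → X` is a closed immersion). [folklore] -/
theorem imageι_app_surjective {W : X.Opens} (hW : IsAffineOpen W) :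
    Function.Surjective ((X.basicOpen (algebraMapΓ f a)).ι.imageι.app W) :=
  Scheme.IdealSheafData.subschemeι_app_surjective _ ⟨W, hW⟩

/-! ### Pull-back of sections to `X̄` -/

/-- `a`-power torsion sections of an affine `W` pull back to zero on `X̄` (pull-back along
`X̄ → X` is the tree's `Sections.comap`, Mathlib `Scheme.Hom.appLE`). [folklore] -/
theorem comap_eq_zero_of_smul_pow_eq_zero {W : X.Opens} (hW : IsAffineOpen W) {x : Sections f W}
    {n : ℕ} (hx : a ^ n • x = 0) :
    Sections.comap f ((X.basicOpen (algebraMapΓ f a)).ι.imageι ≫ f)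
      (X.basicOpen (algebraMapΓ f a)).ι.imageι rfl
      (le_rfl : (X.basicOpen (algebraMapΓ f a)).ι.imageι ⁻¹ᵁ W ≤ _) x = 0 := by
  rw [Sections.comap_apply, ← Scheme.Hom.app_eq_appLE]
  exact (imageι_app_eq_zero_iff f a hW x).mpr ⟨n, hx⟩

/-- Conversely a section of an affine `W` pulling back to zero on `X̄` is `a`-power torsion.
[folklore] -/
theorem exists_smul_pow_eq_zero_of_comap_eq_zero {W : X.Opens} (hW : IsAffineOpen W)
    {x : Sections f W}
    (hx : Sections.comap f ((X.basicOpen (algebraMapΓ f a)).ι.imageι ≫ f)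
      (X.basicOpen (algebraMapΓ f a)).ι.imageι rfl
      (le_rfl : (X.basicOpen (algebraMapΓ f a)).ι.imageι ⁻¹ᵁ W ≤ _) x = 0) :
    ∃ n : ℕ, a ^ n • x = 0 := by
  rw [Sections.comap_apply, ← Scheme.Hom.app_eq_appLE] at hx
  exact (imageι_app_eq_zero_iff f a hW x).mp hx

/-- The pull-back `Γ(X, W) → Γ(X̄, X̄ ∩ W)` is onto for `W` affine. [folklore] -/
theorem comap_surjective {W : X.Opens} (hW : IsAffineOpen W) :
    Function.Surjective (Sections.comap f ((X.basicOpen (algebraMapΓ f a)).ι.imageι ≫ f)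
      (X.basicOpen (algebraMapΓ f a)).ι.imageι rfl
      (le_rfl : (X.basicOpen (algebraMapΓ f a)).ι.imageι ⁻¹ᵁ W ≤ _)) := by
  intro y
  obtain ⟨x, hx⟩ := imageι_app_surjective f a hW y
  refine ⟨x, ?_⟩
  rw [Sections.comap_apply, ← Scheme.Hom.app_eq_appLE]
  exact hx

/-! ### Uniform bound on the `a`-power torsion over finitely many affine opens -/

/-- In the Noetherian ring `Γ(X, W)` the `a`-power torsion is killed by a fixed power of `a`.
[folklore] -/
theorem exists_pow_smul_eq_zero_of_isNoetherianRing {W : X.Opens} [IsNoetherianRing (Sections f W)] :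
    ∃ N : ℕ, ∀ (x : Sections f W) (n : ℕ), a ^ n • x = 0 → a ^ N • x = 0 := by
  let T : ℕ →o Ideal (Sections f W) :=
    { toFun := fun k ↦ LinearMap.ker (LinearMap.mulLeft (Sections f W)
        ((algebraMap A (Sections f W) a) ^ k))
      monotone' := fun k l hkl y hy ↦ by
        rw [LinearMap.mem_ker, LinearMap.mulLeft_apply] at hy ⊢
        obtain ⟨d, rfl⟩ := Nat.exists_eq_add_of_le hkl
        rw [add_comm, pow_add, mul_assoc, hy, mul_zero] }
  have hT : ∀ k (y : Sections f W), y ∈ T k ↔ a ^ k • y = 0 := fun k y ↦ by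
    rw [Algebra.smul_def, map_pow]
    exact ⟨fun h ↦ h, fun h ↦ h⟩
  obtain ⟨N, hN⟩ := (monotone_stabilizes_iff_noetherian.mpr
    (inferInstance : IsNoetherian (Sections f W) (Sections f W))) T
  refine ⟨N, fun x n hx ↦ ?_⟩
  rcases le_or_gt N n with h | h
  · have hx' : x ∈ T n := (hT n x).mpr hx
    rw [← hN n h] at hx'
    exact (hT N x).mp hx'
  · obtain ⟨d, rfl⟩ := Nat.exists_eq_add_of_le h.le
    rw [add_comm, pow_add, mul_smul, hx, smul_zero]

/-- **Uniform torsion bound**: for finitely many affine opens `W_p` of the locally Noetherian `X`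
there is one `N` with `a^n x = 0 ⇒ a^N x = 0` on all `Γ(X, W_p)`. [folklore] -/
theorem exists_uniform_pow_smul_eq_zero [IsLocallyNoetherian X] {P : Type*} [Finite P]
    (W : P → X.Opens)
    (hW : ∀ p, IsAffineOpen (W p)) :
    ∃ N : ℕ, ∀ (p : P) (x : Sections f (W p)) (n : ℕ), a ^ n • x = 0 → a ^ N • x = 0 := by
  haveI : ∀ p, IsNoetherianRing (Sections f (W p)) := fun p ↦
    IsLocallyNoetherian.component_noetherian ⟨W p, hW p⟩
  choose N hN using fun p ↦ exists_pow_smul_eq_zero_of_isNoetherianRing f a (W := W p)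
  haveI := Fintype.ofFinite P
  refine ⟨Finset.univ.sup N, fun p x n hx ↦ ?_⟩
  have hle : N p ≤ Finset.univ.sup N := Finset.le_sup (Finset.mem_univ p)
  obtain ⟨d, hd⟩ := Nat.exists_eq_add_of_le hle
  rw [hd, add_comm, pow_add, mul_smul, hN p x n hx, smul_zero]

/-! ### Torsion data for the graded Čech cohomology of `I = (a)`

The construction only uses the following three properties of the morphism `g : Y → X` (satisfied by
`X̄ → X`, see above): on affine opens `W`, the pull-back `Γ(X, W) → Γ(Y, g⁻¹W)` is onto and its
kernel is exactly the `a`-power torsion. We therefore carry it out for an arbitrary such `g`. -/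

section Psi

variable {Y : Scheme.{u}} (g : Y ⟶ X)
  (hgker : ∀ ⦃W : X.Opens⦄, IsAffineOpen W → ∀ x : Sections f W,
    Sections.comap f (g ≫ f) g rfl (le_rfl : g ⁻¹ᵁ W ≤ _) x = 0 ↔ ∃ n : ℕ, a ^ n • x = 0)
  (hgsurj : ∀ ⦃W : X.Opens⦄, IsAffineOpen W →
    Function.Surjective (Sections.comap f (g ≫ f) g rfl (le_rfl : g ⁻¹ᵁ W ≤ _)))
  {ι' : Type v} (U : ι' → X.Opens) (hU : ∀ i, IsAffineOpen (U i))
  (hU2 : ∀ i j, IsAffineOpen (U i ⊓ U j)) (hU3 : ∀ i j k, IsAffineOpen (U i ⊓ U j ⊓ U k))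

include hU2 in
/-- A cochain of `Č¹(𝒰, 𝓘^{n+1})`, `𝓘 = (a)`, is `a^{n+1} d` for a cochain `d` of `𝒪_X` (the
`U_i ∩ U_j` being affine; `exists_eq_pow_smul_of_app_ι_eq_zero`). [folklore] -/
theorem exists_eq_pow_smul (n : ℕ) {c : CechC1 f U} (hc : c ∈ C1 (Ideal.span {a}) f U n) :
    ∃ d : CechC1 f U, c = a ^ (n + 1) • d := by
  rw [mem_C1_iff] at hc
  choose d hd using fun i j ↦ exists_eq_pow_smul_of_app_ι_eq_zero f a n (hU2 i j) (c i j)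
    ((mem_vanishing_iff _ f _).mp (hc i j))
  exact ⟨fun i j ↦ d i j, funext fun i ↦ funext fun j ↦ hd i j⟩

include hgker hU2 in
/-- Two such `d` have the same pull-back to `Y`: their difference is `a`-power torsion.
[folklore] -/
theorem comapC1_eq_of_pow_smul_eq {n : ℕ} {d d' : CechC1 f U}
    (h : a ^ (n + 1) • d = a ^ (n + 1) • d') :
    cechComapC1 f (g ≫ f) g rfl U d = cechComapC1 f (g ≫ f) g rfl U d' := by
  rw [← sub_eq_zero, ← map_sub]
  funext i j
  rw [cechComapC1_apply]
  refine (hgker (hU2 i j) _).mpr ⟨n + 1, ?_⟩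
  rw [Pi.sub_apply, Pi.sub_apply, smul_sub, sub_eq_zero]
  exact congrFun (congrFun h i) j

include hgker hU3 in
/-- For `z = a^{n+1} d` a cocycle of `𝓘^{n+1}`, the pull-back of `d` to `Y` is a cocycle:
`a^{n+1} d¹ d = d¹ z = 0`, so `d¹ d` is torsion, killed on `Y`. [folklore] -/
theorem comapC1_mem_cechZ1 {n : ℕ} {z d : CechC1 f U} (hz : z ∈ Z1 (Ideal.span {a}) f U n)
    (hd : z = a ^ (n + 1) • d) : cechComapC1 f (g ≫ f) g rfl U d ∈ cechZ1 (g ≫ f) (preimageFamily g U) := by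
  rw [mem_cechZ1_iff, cechD1_comapC1]
  have h0 : a ^ (n + 1) • cechD1 f U d = 0 := by
    rw [← map_smul, ← hd]; exact (mem_cechZ1_iff f U z).mp hz.2
  funext i j k
  rw [cechComapC2_apply]
  exact (hgker (hU3 i j k) _).mpr ⟨n + 1, congrFun (congrFun (congrFun h0 i) j) k⟩

include hgker hU hU2 in
/-- For `z = a^{n+1} d` a coboundary of `𝓘^{n+1}` (`z = d⁰ b`, `b_i = a^{n+1} c_i`), the pull-back
of `d` to `Y` is a coboundary (`= d⁰` of the pull-back of `c`). [folklore] -/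
theorem comapC1_mem_cechB1 {n : ℕ} {z d : CechC1 f U} (hz : z ∈ B1 (Ideal.span {a}) f U n)
    (hd : z = a ^ (n + 1) • d) : cechComapC1 f (g ≫ f) g rfl U d ∈ cechB1 (g ≫ f) (preimageFamily g U) := by
  obtain ⟨b, hb, rfl⟩ := hz
  have hb' := (mem_C0_iff (Ideal.span {a}) f U n b).mp hb
  choose c hc using fun i ↦ exists_eq_pow_smul_of_app_ι_eq_zero f a n (hU i) (b i)
    ((mem_vanishing_iff _ f _).mp (hb' i))
  have hbc : b = a ^ (n + 1) • (fun i ↦ c i : CechC0 f U) := funext fun i ↦ hc i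
  have h : a ^ (n + 1) • d = a ^ (n + 1) • cechD0 f U (fun i ↦ c i) := by
    rw [← hd, ← map_smul, ← hbc]
  rw [comapC1_eq_of_pow_smul_eq f a g hgker U hU2 h, ← cechD0_comapC0]
  exact ⟨_, rfl⟩

include hgker hgsurj hU hU2 in
/-- **Injectivity input**: if `a^N` kills the `a`-power torsion of all `Γ(X, U_i ∩ U_j)` and
`n + 1 ≥ N`, then a cochain `z = a^{n+1} d` of `𝓘^{n+1}` whose `d` pulls back to a coboundary on
`Y` is a coboundary of `𝓘^{n+1}`: lift `d⁰ ē = d|_Y` to `e` on the affine `U_i`; then `d - d⁰ e` is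
torsion, killed by `a^{n+1}`, and `z = d⁰ (a^{n+1} e)`. [folklore] -/
theorem mem_B1_of_comapC1_mem_cechB1 {N n : ℕ} (hNn : N ≤ n + 1)
    (hN : ∀ (i j : ι') (x : Sections f (U i ⊓ U j)) (m : ℕ), a ^ m • x = 0 → a ^ N • x = 0)
    {z d : CechC1 f U} (hd : z = a ^ (n + 1) • d)
    (hB : cechComapC1 f (g ≫ f) g rfl U d ∈ cechB1 (g ≫ f) (preimageFamily g U)) :
    z ∈ B1 (Ideal.span {a}) f U n := by
  obtain ⟨eb, heb⟩ := hB
  choose e he using fun i ↦ hgsurj (hU i) (eb i)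
  have hcomap : cechComapC1 f (g ≫ f) g rfl U (d - cechD0 f U (fun i ↦ e i)) = 0 := by
    rw [map_sub, ← heb, ← cechD0_comapC0, sub_eq_zero]
    congr 1
    funext i
    rw [cechComapC0_apply]
    exact (he i).symm
  have htors : a ^ (n + 1) • (d - cechD0 f U (fun i ↦ e i)) = 0 := by
    funext i j
    have hij : cechComapC1 f (g ≫ f) g rfl U (d - cechD0 f U (fun i ↦ e i)) i j = 0 := by
      rw [hcomap]; rfl
    rw [cechComapC1_apply] at hij
    obtain ⟨m, hm⟩ := (hgker (hU2 i j) _).mp hij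
    have hNx := hN i j _ m hm
    obtain ⟨k, hk⟩ := Nat.exists_eq_add_of_le hNn
    change a ^ (n + 1) • (d - cechD0 f U (fun i ↦ e i)) i j = 0
    rw [hk, add_comm, pow_add, mul_smul, hNx, smul_zero]
  rw [smul_sub, sub_eq_zero, ← hd, ← map_smul] at htors
  refine ⟨a ^ (n + 1) • (fun i ↦ e i), (mem_C0_iff (Ideal.span {a}) f U n _).mpr fun i ↦ ?_, htors.symm⟩
  exact smul_mem_vanishing_of_mem_pow (Ideal.span {a}) f (Ideal.pow_mem_pow (Ideal.mem_span_singleton_self a) _) _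

include hgker hU2 hU3 in
/-- The class `[d|_Y] ∈ Ȟ¹(g⁻¹𝒰, 𝒪_Y)` of a cocycle `z = a^{n+1} d` of `𝓘^{n+1}` does not depend on
the choice of `d`, is additive and `A`-linear in `z`: there is an `A`-linear
`φ_n : Ž¹(𝒰, 𝓘^{n+1}) → Ȟ¹(g⁻¹𝒰, 𝒪_Y)` with `φ_n z = [d|_Y]` whenever `z = a^{n+1} d`. [folklore] -/
theorem exists_linearMap_Z1 (n : ℕ) :
    ∃ φ : ↥(Z1 (Ideal.span {a}) f U n) →ₗ[A] CechH1 (g ≫ f) (preimageFamily g U),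
      ∀ (z : Z1 (Ideal.span {a}) f U n) (d : CechC1 f U) (hd : (z : CechC1 f U) = a ^ (n + 1) • d),
        φ z = CechH1.mk (g ≫ f) (preimageFamily g U)
          ⟨cechComapC1 f (g ≫ f) g rfl U d, comapC1_mem_cechZ1 f a g hgker U hU3 z.2 hd⟩ := by
  have hex : ∀ z : Z1 (Ideal.span {a}) f U n, ∃ d : CechC1 f U, (z : CechC1 f U) = a ^ (n + 1) • d :=
    fun z ↦ exists_eq_pow_smul f a U hU2 n z.2.1
  choose d hd using hex
  have hindep : ∀ (z : Z1 (Ideal.span {a}) f U n) (d' : CechC1 f U) (hd' : (z : CechC1 f U) = a ^ (n + 1) • d'),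
      CechH1.mk (g ≫ f) (preimageFamily g U)
          ⟨cechComapC1 f (g ≫ f) g rfl U (d z), comapC1_mem_cechZ1 f a g hgker U hU3 z.2 (hd z)⟩ =
        CechH1.mk (g ≫ f) (preimageFamily g U)
          ⟨cechComapC1 f (g ≫ f) g rfl U d', comapC1_mem_cechZ1 f a g hgker U hU3 z.2 hd'⟩ := by
    intro z d' hd'
    congr 1
    exact Subtype.ext (comapC1_eq_of_pow_smul_eq f a g hgker U hU2 ((hd z).symm.trans hd'))
  refine ⟨{ toFun := fun z ↦ CechH1.mk (g ≫ f) (preimageFamily g U)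
              ⟨cechComapC1 f (g ≫ f) g rfl U (d z), comapC1_mem_cechZ1 f a g hgker U hU3 z.2 (hd z)⟩
            map_add' := fun z z' ↦ ?_
            map_smul' := fun r z ↦ ?_ }, fun z d' hd' ↦ hindep z d' hd'⟩
  · have hsum : ((z + z' : Z1 (Ideal.span {a}) f U n) : CechC1 f U) = a ^ (n + 1) • (d z + d z') := by
      rw [smul_add, ← hd z, ← hd z']; rfl
    rw [hindep (z + z') _ hsum, ← map_add]
    exact congrArg _ (Subtype.ext (map_add _ _ _))
  · have hsm : ((r • z : Z1 (Ideal.span {a}) f U n) : CechC1 f U) = a ^ (n + 1) • (r • d z) := by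
      rw [smul_comm, ← hd z]; rfl
    rw [RingHom.id_apply, hindep (r • z) _ hsm, ← map_smul]
    exact congrArg _ (Subtype.ext (map_smul _ _ _))

include hgker hU hU2 hU3 in
/-- `φ_n` kills the coboundaries of `𝓘^{n+1}` and so descends to
`Ψ'_n : Ȟ¹(𝒰, 𝓘^{n+1}) → Ȟ¹(g⁻¹𝒰, 𝒪_Y)`, `[a^{n+1} d] ↦ [d|_Y]`. [folklore] -/
theorem exists_linearMap_H1 (n : ℕ) :
    ∃ Ψ' : H1 (Ideal.span {a}) f U n →ₗ[A] CechH1 (g ≫ f) (preimageFamily g U),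
      ∀ (z : Z1 (Ideal.span {a}) f U n) (d : CechC1 f U) (hd : (z : CechC1 f U) = a ^ (n + 1) • d),
        Ψ' (H1.mk (Ideal.span {a}) f U n z) = CechH1.mk (g ≫ f) (preimageFamily g U)
          ⟨cechComapC1 f (g ≫ f) g rfl U d, comapC1_mem_cechZ1 f a g hgker U hU3 z.2 hd⟩ := by
  obtain ⟨φ, hφ⟩ := exists_linearMap_Z1 f a g hgker U hU2 hU3 n
  have hker : (B1 (Ideal.span {a}) f U n).comap (Z1 (Ideal.span {a}) f U n).subtype ≤ LinearMap.ker φ := by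
    intro z hz
    obtain ⟨d, hd⟩ := exists_eq_pow_smul f a U hU2 n z.2.1
    rw [LinearMap.mem_ker, hφ z d hd, CechH1.mk_eq_zero_iff]
    exact comapC1_mem_cechB1 f a g hgker U hU hU2 hz hd
  exact ⟨Submodule.liftQ _ φ hker, fun z d hd ↦ hφ z d hd⟩

include hgker hgsurj hU hU2 hU3 in
/-- **Torsion data for `I = (a)` along `g : Y → X`.** Let `X` be locally Noetherian over `A`,
`a ∈ A`, `𝒰` a finite family of opens with `U_i`, `U_i ∩ U_j`, `U_i ∩ U_j ∩ U_k` affine, and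
`g : Y → X` a morphism such that on affine opens the pull-back of sections is onto with kernel the
`a`-power torsion (e.g. the scheme-theoretic closure of `D(a)`, `exists_torsionData`). Then there
are `n₀` and `A`-linear maps `Ψ_r : Ȟ¹(𝒰, 𝓘^{n₀+r+1}) → Ȟ¹(g⁻¹𝒰, 𝒪_Y)` (`𝓘 = (a)`),
`[a^{n₀+r+1} d] ↦ [d|_Y]`, with `Ψ_r ∘ ρ = a • Ψ_{r+1}` and `Ψ_0` injective (`n₀` a uniform bound
for the `a`-power torsion of the `Γ(U_i ∩ U_j)`). This is the input of
`InfinitesimalCech.exists_restrict_eq_of_torsionData`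
(`Literature/AlgebraicGeometry/Morphisms/FormalFunctionsTorsionML.lean`).
[cite: StacksProject, Tag 02OB (Cohomology of Schemes, Lemma 30.20.1)] -/
theorem exists_torsionData_of [IsLocallyNoetherian X] [Finite ι'] :
    ∃ (n₀ : ℕ) (Ψ : (r : ℕ) → (H1 (Ideal.span {a}) f U (n₀ + r) →ₗ[A] CechH1 (g ≫ f) (preimageFamily g U))),
      (∀ (r : ℕ) (x : H1 (Ideal.span {a}) f U (n₀ + r + 1)), Ψ r (ρ (Ideal.span {a}) f U (n₀ + r) x) = a • Ψ (r + 1) x) ∧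
        Function.Injective (Ψ 0) := by
  -- uniform torsion bound `N` over the `U_i ∩ U_j`
  obtain ⟨N, hN⟩ := exists_uniform_pow_smul_eq_zero f a (fun p : ι' × ι' ↦ U p.1 ⊓ U p.2)
    (fun p ↦ hU2 p.1 p.2)
  choose Ψ' hΨ' using fun n ↦ exists_linearMap_H1 f a g hgker U hU hU2 hU3 n
  refine ⟨N, fun r ↦ Ψ' (N + r), fun r x ↦ ?_, fun x y hxy ↦ ?_⟩
  · -- `Ψ_r (ρ x) = a • Ψ_{r+1} x`
    obtain ⟨z, rfl⟩ := H1.mk_surjective (Ideal.span {a}) f U (N + r + 1) x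
    obtain ⟨d, hd⟩ := exists_eq_pow_smul f a U hU2 (N + r + 1) z.2.1
    have hd' : ((⟨z, Z1_succ_le (Ideal.span {a}) f U (N + r) z.2⟩ : Z1 (Ideal.span {a}) f U (N + r)) : CechC1 f U) =
        a ^ (N + r + 1) • (a • d) := by
      rw [← mul_smul, ← pow_succ, ← hd]
    change Ψ' (N + r) (ρ (Ideal.span {a}) f U (N + r) (H1.mk (Ideal.span {a}) f U (N + r + 1) z)) =
      a • Ψ' (N + r + 1) (H1.mk (Ideal.span {a}) f U (N + r + 1) z)
    rw [ρ_mk, hΨ' (N + r) _ (a • d) hd', hΨ' (N + r + 1) z d hd, ← map_smul]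
    exact congrArg _ (Subtype.ext (map_smul _ _ _))
  · -- `Ψ_0` is injective
    rw [← sub_eq_zero, ← map_sub] at hxy
    rw [← sub_eq_zero]
    obtain ⟨z, hz⟩ := H1.mk_surjective (Ideal.span {a}) f U (N + 0) (x - y)
    obtain ⟨d, hd⟩ := exists_eq_pow_smul f a U hU2 (N + 0) z.2.1
    rw [← hz] at hxy ⊢
    rw [hΨ' (N + 0) z d hd, CechH1.mk_eq_zero_iff] at hxy
    rw [H1.mk_eq_zero_iff]
    exact mem_B1_of_comapC1_mem_cechB1 f a g hgker hgsurj U hU hU2 (N := N) (n := N + 0) (by omega)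
      (fun i j x m hm ↦ hN (i, j) x m hm) hd hxy

end Psi

/-- **Torsion data for `I = (a)` along the scheme-theoretic closure `X̄` of `D(a)`** (the case
`g = (X̄ → X)` of `exists_torsionData_of`, by `imageι_app_eq_zero_iff` and `imageι_app_surjective`).
[cite: StacksProject, Tag 02OB (Cohomology of Schemes, Lemma 30.20.1)] -/
theorem exists_torsionData [IsLocallyNoetherian X] {ι' : Type v} [Finite ι'] (U : ι' → X.Opens)
    (hU : ∀ i, IsAffineOpen (U i)) (hU2 : ∀ i j, IsAffineOpen (U i ⊓ U j))
    (hU3 : ∀ i j k, IsAffineOpen (U i ⊓ U j ⊓ U k)) :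
    ∃ (n₀ : ℕ) (Ψ : (r : ℕ) → (H1 (Ideal.span {a}) f U (n₀ + r) →ₗ[A]
      CechH1 ((X.basicOpen (algebraMapΓ f a)).ι.imageι ≫ f)
        (preimageFamily (X.basicOpen (algebraMapΓ f a)).ι.imageι U))),
      (∀ (r : ℕ) (x : H1 (Ideal.span {a}) f U (n₀ + r + 1)),
        Ψ r (ρ (Ideal.span {a}) f U (n₀ + r) x) = a • Ψ (r + 1) x) ∧
        Function.Injective (Ψ 0) :=
  exists_torsionData_of f a (X.basicOpen (algebraMapΓ f a)).ι.imageι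
    (fun _ hW _ ↦ ⟨exists_smul_pow_eq_zero_of_comap_eq_zero f a hW,
      fun ⟨_, hx⟩ ↦ comap_eq_zero_of_smul_pow_eq_zero f a hW hx⟩)
    (fun _ hW ↦ comap_surjective f a hW) U hU hU2 hU3

end TorsionCech

end Literature.AlgebraicGeometry.Morphisms

end
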